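import Literature.NumberTheory.LFunctions.Zhang2022.Section8Lemma82
import Literature.NumberTheory.LFunctions.RichertBoundsFromExpSum
import Literature.NumberTheory.LFunctions.DirichletLFunctionBounds
import Literature.NumberTheory.LFunctions.RHInvZetaBound
import HarnessLib

/-!
# Zhang (2022) §8: the `L(s,χ)`-floor behind the Lemma 8.4 contour move

Trunk T-ANT (NumberTheory/LFunctions). DAG node context: `Z22:Lem8.4.pf`
[Zhang2022LandauSiegel, §8 p. 46, tex L2401–2417]. The printed proof of Lemma 8.4 moves the
Perron contour of (8.9) "in the same way as in the proof of Lemma 8.2" [tex L2405]. Unlike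
Lemma 8.2's integrand (one `L` in the numerator, entire), the (8.9) integrand carries the factor
`1/L(1+s,χ)`, so on the moved segment `Re(1+s) = 1 − 𝓛⁻¹`, `|t| ≤ D` the size estimate needs a
LOWER bound for `‖L(s,χ)‖` there — an inference the manuscript does not spell out. This file
proves that inference in the kernel, from the zero-free data the manuscript itself supplies
(Lemma 5.5: under (A), `L(s,χ)` has a simple real zero `ρ̃` with `1 − ρ̃ = O(𝓛⁻²⁰²²)` and no
other zero in `σ > 1 − 2𝓛⁻¹`, `|t| < 2D`; tree: `Skeleton.lemma55_holds`).

Contents (χ-generic; `ε` plays `1/𝓛`; no Zhang-skeleton imports, so the statements are usable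
both by the `Skeleton` consumers and by the typed-section dischargers):

* `log_norm_ge_of_ball` — abstract Borel–Carathéodory floor: a zero-free holomorphic `F` on
  `ball c R` with `log‖F‖ ≤ log‖F c‖ + M` has `log‖F z‖ ≥ log‖F c‖ − 2Mr/(R−r)` on
  `closedBall c r` (Mathlib `Complex.borelCaratheodory_zero` + the tree's holomorphic
  logarithm `InvZetaRH.exists_log_of_ball`).
* `norm_ge_of_ball_of_le` — multiplicative form: `m^(k+1) ≤ ‖F z‖ · B^k` when
  `m ≤ ‖F c‖`, `‖F‖ ≤ B` on the ball and `2r/(R−r) ≤ k`.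
* `norm_LFunction_le_right` — `‖L(s,χ)‖ ≤ 3 + log q + log(‖s‖+1)` for `1 ≤ σ`
  (head/tail partial summation; companion to `Lemma82.norm_LFunction_le_left`).
* `norm_LFunction_le_on_ball` — the explicit upper bound
  `B(q,t,ε) = (q(|t|+3))^{2ε} (4 + log q + log(|t|+3))` on `ball (1+ε+it) (3ε)` for
  `0 < ε ≤ 1/8`.
* `norm_LFunction_ge_of_zerofree` — AWAY case: if `L(·,χ)` has no zero on `ball (1+ε+it) (3ε)`
  then `(ε/(1+ε))^9 ≤ ‖L z‖ · B^8` on `closedBall (1+ε+it) (12ε/5)`.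
* `norm_LFunction_ge_of_simple_zero` — NEAR case (`|t| ≤ 3ε`): with the simple real zero
  `ρ ∈ [1−ε/2, 1]` the unique zero on the ball,
  `‖z−ρ‖ · (1/6)^13 ≤ ‖L z‖ · (20B/ε)^12` there (`dslope`-factorisation + maximum modulus
  with an adaptive sphere radius + Borel–Carathéodory).

Consumers instantiate `ε = 1/𝓛`, `|t| ≤ D`: then `B ≤ e⁴·(4 + 2𝓛 + 2)`-sized, so the floors are
`𝓛^{-O(1)}` (times `‖z−ρ̃‖ ≥ 𝓛⁻¹/2` on the segment in the near case) — exactly what the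
`x^{−1/𝓛} ≤ exp(−𝓛^{0.1})` saving of the Lemma 8.2-style contour needs (cf.
`Lemma82.rpow_neg_inv_log_mul_le`). Status of the source: an unrefereed manuscript under
adjudication; this file asserts nothing about Theorems 1–2 or Landau–Siegel zeros — it proves
an inference of the printed proof from the printed zero-free data, stated over an arbitrary
Dirichlet character.
-/

noncomputable section

open Complex Metric Set Real

namespace Literature.NumberTheory.LFunctions.Zhang2022.Section8Floor

/-- **Borel–Carathéodory lower bound on a disc** [cite: MontgomeryVaughan2007, Ch. 6, Lemma 6.2
with the standard exponentiation step]: if `F` is holomorphic and zero-free on `ball c R` and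
`log ‖F z‖ ≤ log ‖F c‖ + M` there (`M > 0`), then on `closedBall c r` (`r < R`)
`log ‖F z‖ ≥ log ‖F c‖ − 2Mr/(R−r)`. Proof: a holomorphic logarithm `h` of `F/F(c)` vanishing
at `c` (tree `InvZetaRH.exists_log_of_ball`) has `Re h ≤ M`, so Mathlib's
`Complex.borelCaratheodory_zero` bounds `‖h‖ ≤ 2M‖z−c‖/(R−‖z−c‖)`, and `Re h ≥ −‖h‖`. -/
theorem log_norm_ge_of_ball {F : ℂ → ℂ} {c : ℂ} {R M : ℝ} (hM : 0 < M)
    (hF : DifferentiableOn ℂ F (ball c R)) (hF0 : ∀ z ∈ ball c R, F z ≠ 0)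
    (hbd : ∀ z ∈ ball c R, Real.log ‖F z‖ ≤ Real.log ‖F c‖ + M)
    {r : ℝ} (hr0 : 0 ≤ r) (hrR : r < R) {z : ℂ} (hz : z ∈ closedBall c r) :
    Real.log ‖F c‖ - 2 * M * r / (R - r) ≤ Real.log ‖F z‖ := by
  have hR : 0 < R := lt_of_le_of_lt hr0 hrR
  obtain ⟨Lg, hLd, -, -, hexp⟩ :=
    Literature.NumberTheory.LFunctions.InvZetaRH.exists_log_of_ball hR hF hF0
  -- the shifted, centred logarithm `g w = Lg (c + w) − Lg c` on `ball 0 R`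
  set g : ℂ → ℂ := fun w => Lg (c + w) - Lg c with hg
  have hmaps : ∀ w : ℂ, w ∈ ball (0 : ℂ) R → c + w ∈ ball c R := by
    intro w hw
    simpa [mem_ball, dist_eq_norm] using hw
  have hgd : DifferentiableOn ℂ g (ball 0 R) := by
    refine DifferentiableOn.sub_const ?_ _
    exact hLd.comp ((differentiableOn_const c).add differentiableOn_id) fun w hw => hmaps w hw
  have hg0 : g 0 = 0 := by simp [hg]
  -- `Re (Lg w) = log ‖F w‖` on the ball
  have hre : ∀ w ∈ ball c R, (Lg w).re = Real.log ‖F w‖ := by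
    intro w hw
    have h1 : ‖F w‖ = Real.exp (Lg w).re := by rw [← hexp w hw, Complex.norm_exp]
    rw [h1, Real.log_exp]
  have hcball : c ∈ ball c R := mem_ball_self hR
  have hgre : ∀ w ∈ ball (0 : ℂ) R, (g w).re ≤ M := by
    intro w hw
    have hcw := hmaps w hw
    have : (g w).re = Real.log ‖F (c + w)‖ - Real.log ‖F c‖ := by
      simp [hg, Complex.sub_re, hre _ hcw, hre _ hcball]
    rw [this]
    linarith [hbd _ hcw]
  -- Borel–Carathéodory at `w = z − c`
  have hzr : ‖z - c‖ ≤ r := by simpa [mem_closedBall, dist_eq_norm] using hz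
  have hzball : z - c ∈ ball (0 : ℂ) R := by
    simp only [mem_ball, dist_zero_right]
    exact lt_of_le_of_lt hzr hrR
  have hbc := Complex.borelCaratheodory_zero hM hgd
    (fun w hw => hgre w hw) hR hzball hg0
  -- monotonicity `x ↦ x/(R−x)` on `[0, R)`
  have hmono : 2 * M * ‖z - c‖ / (R - ‖z - c‖) ≤ 2 * M * r / (R - r) := by
    have h1 : 0 < R - ‖z - c‖ := by
      have := lt_of_le_of_lt hzr hrR
      linarith
    have h2 : 0 < R - r := by linarith
    rw [div_le_div_iff₀ h1 h2]
    have hn : (0 : ℝ) ≤ ‖z - c‖ := norm_nonneg _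
    nlinarith [mul_nonneg (mul_nonneg hM.le (sub_nonneg.mpr hzr)) hR.le]
  have hgb : ‖g (z - c)‖ ≤ 2 * M * r / (R - r) := le_trans hbc hmono
  -- `Re g ≥ −‖g‖` and unwind
  have hrez : (g (z - c)).re = Real.log ‖F z‖ - Real.log ‖F c‖ := by
    have hcz : c + (z - c) = z := by ring
    have := hre _ (hmaps _ hzball)
    rw [hcz] at this
    simp [hg, Complex.sub_re, this, hre _ hcball]
  have habs : -(2 * M * r / (R - r)) ≤ (g (z - c)).re := by
    have h := abs_re_le_norm (g (z - c))
    have := neg_le_of_abs_le h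
    linarith [hgb]
  rw [hrez] at habs
  linarith

/-- **Multiplicative Borel–Carathéodory floor**: `F` holomorphic and zero-free on `ball c R`,
`0 < m ≤ ‖F c‖`, `‖F‖ ≤ B` on the ball, `m < B`, and `2r/(R−r) ≤ k`; then
`m^(k+1) ≤ ‖F z‖ · B^k` on `closedBall c r`. [cite: MontgomeryVaughan2007, Ch. 6, Lemma 6.2] -/
theorem norm_ge_of_ball_of_le {F : ℂ → ℂ} {c : ℂ} {R m B : ℝ}
    (hF : DifferentiableOn ℂ F (ball c R)) (hF0 : ∀ z ∈ ball c R, F z ≠ 0)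
    (hm : 0 < m) (hmc : m ≤ ‖F c‖) (hB : ∀ z ∈ ball c R, ‖F z‖ ≤ B) (hmB : m < B)
    {r : ℝ} (hr0 : 0 ≤ r) (hrR : r < R) {k : ℕ} (hk : 2 * r / (R - r) ≤ k)
    {z : ℂ} (hz : z ∈ closedBall c r) :
    m ^ (k + 1) ≤ ‖F z‖ * B ^ k := by
  have hR : 0 < R := lt_of_le_of_lt hr0 hrR
  have hB0 : 0 < B := lt_trans hm hmB
  set M : ℝ := Real.log B - Real.log m with hMdef
  have hM : 0 < M := sub_pos.mpr (Real.log_lt_log hm hmB)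
  have hbd : ∀ w ∈ ball c R, Real.log ‖F w‖ ≤ Real.log ‖F c‖ + M := by
    intro w hw
    have h1 : Real.log ‖F w‖ ≤ Real.log B := by
      have h0 : 0 < ‖F w‖ := norm_pos_iff.mpr (hF0 w hw)
      exact Real.log_le_log h0 (hB w hw)
    have h2 : Real.log m ≤ Real.log ‖F c‖ := Real.log_le_log hm hmc
    rw [hMdef]; linarith
  have hfloor := log_norm_ge_of_ball hM hF hF0 hbd hr0 hrR hz
  -- `2Mr/(R−r) ≤ kM`
  have hkM : 2 * M * r / (R - r) ≤ k * M := by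
    have h2 : 0 < R - r := by linarith
    have : 2 * M * r / (R - r) = M * (2 * r / (R - r)) := by ring
    rw [this]
    calc M * (2 * r / (R - r)) ≤ M * k := by
          exact mul_le_mul_of_nonneg_left hk hM.le
      _ = k * M := by ring
  have hlogz : (k + 1 : ℝ) * Real.log m - k * Real.log B ≤ Real.log ‖F z‖ := by
    have h2 : Real.log m ≤ Real.log ‖F c‖ := Real.log_le_log hm hmc
    have : Real.log ‖F c‖ - k * M ≤ Real.log ‖F z‖ := by
      linarith [hfloor, hkM]
    rw [hMdef] at this
    nlinarith [h2, Nat.cast_nonneg (α := ℝ) k]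
  -- exponentiate
  have hzc : z ∈ ball c R := lt_of_le_of_lt (mem_closedBall.mp hz) hrR
  have hFz : 0 < ‖F z‖ := norm_pos_iff.mpr (hF0 z (by simpa [mem_ball] using hzc))
  have hexp := Real.exp_le_exp.mpr hlogz
  have hL : Real.exp ((k + 1 : ℝ) * Real.log m - k * Real.log B) =
      m ^ (k + 1) / B ^ k := by
    rw [Real.exp_sub]
    have e1 : ((k : ℝ) + 1) * Real.log m = ((k + 1 : ℕ) : ℝ) * Real.log m := by
      push_cast; ring
    rw [e1, Real.exp_nat_mul, Real.exp_nat_mul, Real.exp_log hm, Real.exp_log hB0]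
  rw [hL, Real.exp_log hFz] at hexp
  have hBk : 0 < B ^ k := pow_pos hB0 k
  calc m ^ (k + 1) = m ^ (k + 1) / B ^ k * B ^ k := by field_simp
    _ ≤ ‖F z‖ * B ^ k := by
        exact mul_le_mul_of_nonneg_right hexp hBk.le

section LFunction

variable {q : ℕ} [NeZero q] (χ : DirichletCharacter ℂ q)

/-- **`L(s,χ)` for `1 ≤ σ`**: `‖L(s,χ)‖ ≤ 3 + log q + log(‖s‖+1)` for `χ ≠ χ₀` — the
right-of-`1` companion to `Lemma82.norm_LFunction_le_left`, by the same head/tail split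
(head `≤ 1 + log N`, tail `≤ 2` at `N = q(⌊‖s‖⌋+1)`).
[cite: MontgomeryVaughan2007, §4.3 (4.23) and Thm. 4.8] -/
theorem norm_LFunction_le_right (hχ : χ ≠ 1) {s : ℂ} (hσ1 : 1 ≤ s.re) :
    ‖χ.LFunction s‖ ≤ 3 + Real.log q + Real.log (‖s‖ + 1) := by
  have hs0 : 0 < s.re := by linarith
  have hq1 : 1 ≤ q := NeZero.one_le
  have hq0 : (0 : ℝ) < q := by exact_mod_cast NeZero.pos q
  set N : ℕ := q * (⌊‖s‖⌋₊ + 1) with hNdef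
  have hN1 : 1 ≤ N := Nat.one_le_iff_ne_zero.2 (Nat.mul_ne_zero (by omega) (by omega))
  have hN0 : (0 : ℝ) < N := by exact_mod_cast hN1
  have hNR : (N : ℝ) = q * ((⌊‖s‖⌋₊ : ℝ) + 1) := by rw [hNdef]; push_cast; ring
  have hfl : ‖s‖ < (⌊‖s‖⌋₊ : ℝ) + 1 := Nat.lt_floor_add_one ‖s‖
  have hsN : (q : ℝ) * ‖s‖ ≤ N := by
    rw [hNR]; exact mul_le_mul_of_nonneg_left hfl.le hq0.le
  have hqN : (q : ℝ) ≤ N := by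
    rw [hNR]
    have : (1 : ℝ) ≤ (⌊‖s‖⌋₊ : ℝ) + 1 := by
      have := Nat.cast_nonneg (α := ℝ) ⌊‖s‖⌋₊; linarith
    nlinarith
  have hNle : (N : ℝ) ≤ q * (‖s‖ + 1) := by
    rw [hNR]
    have : (⌊‖s‖⌋₊ : ℝ) ≤ ‖s‖ := Nat.floor_le (norm_nonneg s)
    exact mul_le_mul_of_nonneg_left (by linarith) hq0.le
  -- head: `σ ≥ 1` makes every term `≤ 1/(n+1)`
  have hhead : ‖∑ n ∈ Finset.range N, χ ((n + 1 : ℕ) : ZMod q) * ((n + 1 : ℕ) : ℂ) ^ (-s)‖ ≤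
      1 + Real.log N := by
    calc ‖∑ n ∈ Finset.range N, χ ((n + 1 : ℕ) : ZMod q) * ((n + 1 : ℕ) : ℂ) ^ (-s)‖
        ≤ ∑ n ∈ Finset.range N, ‖χ ((n + 1 : ℕ) : ZMod q) * ((n + 1 : ℕ) : ℂ) ^ (-s)‖ :=
          norm_sum_le _ _
      _ ≤ ∑ n ∈ Finset.range N, 1 / ((n + 1 : ℕ) : ℝ) := by
          refine Finset.sum_le_sum fun n _ => ?_
          have hn1 : (0 : ℝ) < ((n + 1 : ℕ) : ℝ) := by positivity
          have h1n : (1 : ℝ) ≤ ((n + 1 : ℕ) : ℝ) := by exact_mod_cast Nat.le_add_left 1 n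
          rw [norm_mul, Complex.norm_natCast_cpow_of_pos (Nat.succ_pos n), neg_re]
          have hχ1 : ‖χ ((n + 1 : ℕ) : ZMod q)‖ ≤ 1 := χ.norm_le_one _
          have hpow : ((n + 1 : ℕ) : ℝ) ^ (-s.re) ≤ ((n + 1 : ℕ) : ℝ) ^ (-(1 : ℝ)) :=
            Real.rpow_le_rpow_of_exponent_le h1n (by linarith)
          have hinv : ((n + 1 : ℕ) : ℝ) ^ (-(1 : ℝ)) = 1 / ((n + 1 : ℕ) : ℝ) := by
            rw [Real.rpow_neg_one, one_div]
          calc ‖χ ((n + 1 : ℕ) : ZMod q)‖ * ((n + 1 : ℕ) : ℝ) ^ (-s.re)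
              ≤ 1 * (((n + 1 : ℕ) : ℝ) ^ (-(1 : ℝ))) := by
                exact mul_le_mul hχ1 hpow (by positivity) zero_le_one
            _ = 1 / ((n + 1 : ℕ) : ℝ) := by rw [one_mul, hinv]
      _ ≤ 1 + Real.log N := Literature.NumberTheory.LFunctions.Zhang2022.Lemma82.sum_inv_le_one_add_log N
  -- tail: `q N^{−σ}(1 + ‖s‖/σ) ≤ 2`
  have htail := Literature.NumberTheory.LFunctions.RichertFromExpSum.norm_LFunction_sub_sum_range_le
    χ hχ hs0 hN1
  have htail2 : (q : ℝ) * (N : ℝ) ^ (-s.re) * (1 + ‖s‖ / s.re) ≤ 2 := by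
    have hNs : (N : ℝ) ^ (-s.re) ≤ (N : ℝ) ^ (-(1 : ℝ)) :=
      Real.rpow_le_rpow_of_exponent_le (by exact_mod_cast hN1) (by linarith)
    have hNinv : (N : ℝ) ^ (-(1 : ℝ)) = (N : ℝ)⁻¹ := by rw [Real.rpow_neg_one]
    have hdiv : ‖s‖ / s.re ≤ ‖s‖ := by
      rw [div_le_iff₀ hs0]
      nlinarith [norm_nonneg s]
    have h1 : (q : ℝ) * (N : ℝ) ^ (-s.re) * (1 + ‖s‖ / s.re) ≤
        (q : ℝ) * (N : ℝ)⁻¹ * (1 + ‖s‖) := by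
      have ha : (0 : ℝ) ≤ (q : ℝ) := hq0.le
      have hb : (0 : ℝ) ≤ 1 + ‖s‖ / s.re := by positivity
      have hc : (q : ℝ) * (N : ℝ) ^ (-s.re) ≤ (q : ℝ) * (N : ℝ)⁻¹ := by
        rw [← hNinv]; exact mul_le_mul_of_nonneg_left hNs ha
      calc (q : ℝ) * (N : ℝ) ^ (-s.re) * (1 + ‖s‖ / s.re)
          ≤ (q : ℝ) * (N : ℝ)⁻¹ * (1 + ‖s‖ / s.re) := by
            exact mul_le_mul_of_nonneg_right hc hb
        _ ≤ (q : ℝ) * (N : ℝ)⁻¹ * (1 + ‖s‖) := by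
            have : (0 : ℝ) ≤ (q : ℝ) * (N : ℝ)⁻¹ := by positivity
            exact mul_le_mul_of_nonneg_left (by linarith) this
    have h2 : (q : ℝ) * (N : ℝ)⁻¹ * (1 + ‖s‖) ≤ 2 := by
      have hqd : (q : ℝ) * (N : ℝ)⁻¹ * 1 ≤ 1 := by
        rw [mul_one]
        rw [mul_inv_le_iff₀ hN0]
        linarith [hqN]
      have hsd : (q : ℝ) * (N : ℝ)⁻¹ * ‖s‖ ≤ 1 := by
        have h1 : (q : ℝ) * (N : ℝ)⁻¹ * ‖s‖ = (N : ℝ)⁻¹ * ((q : ℝ) * ‖s‖) := by ring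
        have h2 : (N : ℝ)⁻¹ * ((q : ℝ) * ‖s‖) ≤ (N : ℝ)⁻¹ * (N : ℝ) :=
          mul_le_mul_of_nonneg_left hsN (inv_nonneg.mpr hN0.le)
        rw [h1]
        calc (N : ℝ)⁻¹ * ((q : ℝ) * ‖s‖) ≤ (N : ℝ)⁻¹ * (N : ℝ) := h2
          _ = 1 := inv_mul_cancel₀ hN0.ne'
      nlinarith [hqd, hsd]
    linarith
  have hlogN : Real.log N ≤ Real.log q + Real.log (‖s‖ + 1) := by
    rw [← Real.log_mul hq0.ne' (by positivity)]
    exact Real.log_le_log hN0 hNle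
  have := norm_le_norm_add_norm_sub' (χ.LFunction s)
    (∑ n ∈ Finset.range N, χ ((n + 1 : ℕ) : ZMod q) * ((n + 1 : ℕ) : ℂ) ^ (-s))
  calc ‖χ.LFunction s‖ ≤ (1 + Real.log N) + 2 := by linarith [htail, htail2, hhead]
    _ ≤ 3 + Real.log q + Real.log (‖s‖ + 1) := by linarith [hlogN]

/-- **The explicit upper bound on the working ball**: for `χ ≠ χ₀`, `0 < ε ≤ 1/8` and any `t`,
on `ball (1+ε+it) (3ε)` one has `‖L(z,χ)‖ ≤ (q(|t|+3))^{2ε} · (4 + log q + log(|t|+3))`.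
Combines `Lemma82.norm_LFunction_le_left` (for `σ ≤ 1`; there `1 − σ < 2ε`) with
`norm_LFunction_le_right` (for `1 ≤ σ`).
[cite: MontgomeryVaughan2007, §4.3; Zhang2022LandauSiegel, §8 Lemma 8.4 (context)] -/
theorem norm_LFunction_le_on_ball (hχ : χ ≠ 1) {ε t : ℝ} (hε0 : 0 < ε) (hε : ε ≤ 1 / 8)
    {z : ℂ} (hz : z ∈ ball (1 + ε + t * I : ℂ) (3 * ε)) :
    ‖χ.LFunction z‖ ≤ ((q : ℝ) * (|t| + 3)) ^ (2 * ε) * (4 + Real.log q + Real.log (|t| + 3)) := by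
  have hq1 : 1 ≤ q := NeZero.one_le
  have hq0 : (0 : ℝ) < q := by exact_mod_cast NeZero.pos q
  have hq1R : (1 : ℝ) ≤ q := by exact_mod_cast hq1
  have hcre : (1 + (ε : ℂ) + t * I).re = 1 + ε := by simp
  have hcim : (1 + (ε : ℂ) + t * I).im = t := by simp
  have hzball : ‖z - (1 + ε + t * I : ℂ)‖ < 3 * ε := by
    simpa [mem_ball, dist_eq_norm] using hz
  have hre_close : |z.re - (1 + ε)| < 3 * ε := by
    have h := abs_re_le_norm (z - (1 + ε + t * I : ℂ))
    have : (z - (1 + ε + t * I : ℂ)).re = z.re - (1 + ε) := by simp [Complex.sub_re, hcre]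
    rw [this] at h
    linarith
  have him_close : |z.im - t| < 3 * ε := by
    have h := abs_im_le_norm (z - (1 + ε + t * I : ℂ))
    have : (z - (1 + ε + t * I : ℂ)).im = z.im - t := by simp [Complex.sub_im, hcim]
    rw [this] at h
    linarith
  have hre_lo : 1 - 2 * ε < z.re := by
    have := abs_lt.mp hre_close
    linarith [this.1]
  have hre_hi : z.re < 1 + 4 * ε := by
    have := abs_lt.mp hre_close
    linarith [this.2]
  -- `‖z‖ + 1 ≤ |t| + 3`
  have hnz : ‖z‖ + 1 ≤ |t| + 3 := by
    have h1 : ‖z‖ ≤ ‖(1 + ε + t * I : ℂ)‖ + 3 * ε := by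
      have h2 := norm_sub_norm_le z (1 + ε + t * I : ℂ)
      linarith [hzball]
    have h3 : ‖(1 + ε + t * I : ℂ)‖ ≤ (1 + ε) + |t| := by
      calc ‖(1 + ε + t * I : ℂ)‖ ≤ ‖(1 + ε : ℂ)‖ + ‖(t : ℂ) * I‖ := by
            have : (1 + ε + t * I : ℂ) = (1 + (ε : ℂ)) + (t : ℂ) * I := by ring
            rw [this]; exact norm_add_le _ _
        _ = (1 + ε) + |t| := by
            rw [norm_mul, Complex.norm_I, mul_one]
            congr 1
            · rw [show (1 + (ε : ℂ)) = ((1 + ε : ℝ) : ℂ) by push_cast; ring,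
                Complex.norm_real, Real.norm_eq_abs, abs_of_pos (by linarith)]
            · exact Complex.norm_real t ▸ Real.norm_eq_abs t
    linarith
  have ht3 : (1 : ℝ) ≤ |t| + 3 := by linarith [abs_nonneg t]
  have hbase1 : (1 : ℝ) ≤ (q : ℝ) * (|t| + 3) := by nlinarith [abs_nonneg t]
  have hrpow1 : (1 : ℝ) ≤ ((q : ℝ) * (|t| + 3)) ^ (2 * ε) :=
    Real.one_le_rpow hbase1 (by positivity)
  have hlog_mono : Real.log (‖z‖ + 1) ≤ Real.log (|t| + 3) :=
    Real.log_le_log (by positivity) hnz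
  have hlogq0 : 0 ≤ Real.log q := Real.log_nonneg hq1R
  have hlogt0 : 0 ≤ Real.log (|t| + 3) := Real.log_nonneg ht3
  rcases le_or_gt z.re 1 with hσ | hσ
  · -- left: `Lemma82.norm_LFunction_le_left`
    have hσ0 : 1 / 2 ≤ z.re := by linarith
    have h := Literature.NumberTheory.LFunctions.Zhang2022.Lemma82.norm_LFunction_le_left
      χ hχ hσ0 hσ
    have hexp_le : (1 : ℝ) - z.re ≤ 2 * ε := by linarith
    have hbase1' : (1 : ℝ) ≤ (q : ℝ) * (‖z‖ + 1) := by
      nlinarith [norm_nonneg z]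
    have hpow1 : ((q : ℝ) * (‖z‖ + 1)) ^ (1 - z.re) ≤ ((q : ℝ) * (‖z‖ + 1)) ^ (2 * ε) :=
      Real.rpow_le_rpow_of_exponent_le hbase1' hexp_le
    have hpow2 : ((q : ℝ) * (‖z‖ + 1)) ^ (2 * ε) ≤ ((q : ℝ) * (|t| + 3)) ^ (2 * ε) := by
      refine Real.rpow_le_rpow (by positivity) ?_ (by positivity)
      nlinarith [hnz]
    have hfac : 4 + Real.log q + Real.log (‖z‖ + 1) ≤
        4 + Real.log q + Real.log (|t| + 3) := by linarith
    have hfac0 : (0 : ℝ) ≤ 4 + Real.log q + Real.log (‖z‖ + 1) := by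
      have : 0 ≤ Real.log (‖z‖ + 1) := Real.log_nonneg (by linarith [norm_nonneg z])
      linarith
    calc ‖χ.LFunction z‖
        ≤ ((q : ℝ) * (‖z‖ + 1)) ^ (1 - z.re) * (4 + Real.log q + Real.log (‖z‖ + 1)) := h
      _ ≤ ((q : ℝ) * (|t| + 3)) ^ (2 * ε) * (4 + Real.log q + Real.log (|t| + 3)) := by
          exact mul_le_mul (le_trans hpow1 hpow2) hfac hfac0
            (by positivity)
  · -- right: `norm_LFunction_le_right`
    have h := norm_LFunction_le_right χ hχ hσ.le
    calc ‖χ.LFunction z‖ ≤ 3 + Real.log q + Real.log (‖z‖ + 1) := h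
      _ ≤ 4 + Real.log q + Real.log (|t| + 3) := by linarith
      _ ≤ ((q : ℝ) * (|t| + 3)) ^ (2 * ε) * (4 + Real.log q + Real.log (|t| + 3)) := by
          nlinarith [hrpow1, hlogq0, hlogt0]

/-- **AWAY floor** — the `1/L`-size inference of the printed contour move in the proof of
Lemma 8.4. [cite: Zhang2022LandauSiegel, §8 Lemma 8.4 proof (tex L2405), with §5 Lemma 5.5]
[cite: MontgomeryVaughan2007, Ch. 6, Lemma 6.2 (method)] If
`L(·,χ)` has no zero on `ball (1+ε+it) (3ε)` (`0 < ε ≤ 1/8`) and `‖L‖ ≤ B` there (`4 ≤ B`),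
then `(ε/(1+ε))^9 ≤ ‖L(z,χ)‖ · B^8` for every `z ∈ closedBall (1+ε+it) (12ε/5)` — in
particular on the moved-contour segment `Re z = 1 − ε`, `Im z = t`. Consumed with the zero-free
region of [Zhang2022LandauSiegel, §5 Lemma 5.5] (tree `Skeleton.lemma55_holds`), which supplies
the zero-freeness for `3ε ≤ |t|` (`ε = 1/𝓛`). -/
theorem norm_LFunction_ge_of_zerofree (hχ : χ ≠ 1) {ε t : ℝ} (hε0 : 0 < ε) (hε : ε ≤ 1 / 8)
    (hzf : ∀ w ∈ ball (1 + ε + t * I : ℂ) (3 * ε), χ.LFunction w ≠ 0)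
    {B : ℝ} (hB4 : 4 ≤ B) (hB : ∀ w ∈ ball (1 + ε + t * I : ℂ) (3 * ε), ‖χ.LFunction w‖ ≤ B)
    {z : ℂ} (hz : z ∈ closedBall (1 + ε + t * I : ℂ) (12 / 5 * ε)) :
    (ε / (1 + ε)) ^ 9 ≤ ‖χ.LFunction z‖ * B ^ 8 := by
  have hdiff : DifferentiableOn ℂ χ.LFunction (ball (1 + ε + t * I : ℂ) (3 * ε)) := by
    intro w _
    exact (DirichletCharacter.differentiableAt_LFunction χ w (Or.inr hχ)).differentiableWithinAt
  have hcre : (1 + (ε : ℂ) + t * I).re = 1 + ε := by simp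
  have hm0 : (0 : ℝ) < ε / (1 + ε) := by positivity
  have hmc : ε / (1 + ε) ≤ ‖χ.LFunction (1 + ε + t * I : ℂ)‖ := by
    have h := Literature.NumberTheory.LFunctions.DirichletZFR.norm_LFunction_ge χ
      (s := (1 + ε + t * I : ℂ)) (by rw [hcre]; linarith)
    rw [hcre] at h
    have : (1 + ε - 1) / (1 + ε) = ε / (1 + ε) := by ring_nf
    linarith [this ▸ h]
  have hmB : ε / (1 + ε) < B := by
    have h1 : ε / (1 + ε) ≤ 1 := by
      rw [div_le_one (by linarith)]; linarith
    linarith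
  have h8 : 2 * (12 / 5 * ε) / (3 * ε - 12 / 5 * ε) ≤ (8 : ℕ) := by
    have h1 : 3 * ε - 12 / 5 * ε = 3 / 5 * ε := by ring
    rw [h1]
    rw [div_le_iff₀ (by positivity)]
    push_cast
    nlinarith
  have := norm_ge_of_ball_of_le (c := (1 + ε + t * I : ℂ)) (R := 3 * ε)
    hdiff hzf hm0 hmc hB hmB (by positivity) (by nlinarith) h8 hz
  simpa using this

/-- **NEAR floor** — the same inference at low heights, with the exceptional zero factored out.
[cite: Zhang2022LandauSiegel, §8 Lemma 8.4 proof (tex L2405), with §5 Lemma 5.5]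
[cite: MontgomeryVaughan2007, Ch. 6, Lemma 6.2 (method)] For `|t| ≤ 3ε` (`0 < ε ≤ 1/8`), if the simple real zero
`ρ ∈ [1 − ε/2, 1]` of `L(·,χ)` is the ONLY zero on `ball (1+ε+it) (3ε)` and `‖L‖ ≤ B` there
(`4 ≤ B`), then `‖z − ρ‖ · (1/6)^13 ≤ ‖L(z,χ)‖ · (20B/ε)^12` on `closedBall (1+ε+it) (12ε/5)`.
Proof: factor `L(z) = (z−ρ) · dslope L ρ z` (Mathlib `sub_smul_dslope_of_zero`); `dslope L ρ` is
entire (`Complex.differentiableOn_dslope`), zero-free on the ball, `≤ 20B/ε` on a sphere of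
adaptive radius `∈ {14ε/5, 29ε/10}` kept `ε/20` away from `ρ` (maximum modulus,
`Complex.norm_le_of_forall_mem_frontier_norm_le`), and `≥ 1/6` at the centre; apply
`norm_ge_of_ball_of_le` with `k = 12`. -/
theorem norm_LFunction_ge_of_simple_zero (hχ : χ ≠ 1) {ε t : ℝ} (hε0 : 0 < ε) (hε : ε ≤ 1 / 8)
    (hT : |t| ≤ 3 * ε) {ρ : ℝ} (hρ0 : χ.LFunction (ρ : ℂ) = 0)
    (hρd : deriv χ.LFunction (ρ : ℂ) ≠ 0) (hρ1 : 1 - ε / 2 ≤ ρ) (hρle : ρ ≤ 1)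
    (huniq : ∀ w ∈ ball (1 + ε + t * I : ℂ) (3 * ε), χ.LFunction w = 0 → w = (ρ : ℂ))
    {B : ℝ} (hB4 : 4 ≤ B) (hB : ∀ w ∈ ball (1 + ε + t * I : ℂ) (3 * ε), ‖χ.LFunction w‖ ≤ B)
    {z : ℂ} (hz : z ∈ closedBall (1 + ε + t * I : ℂ) (12 / 5 * ε)) :
    ‖z - (ρ : ℂ)‖ * (1 / 6 : ℝ) ^ 13 ≤ ‖χ.LFunction z‖ * (20 * B / ε) ^ 12 := by
  set c : ℂ := 1 + ε + t * I with hc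
  have hLdiff : Differentiable ℂ χ.LFunction := fun w =>
    DirichletCharacter.differentiableAt_LFunction χ w (Or.inr hχ)
  set F : ℂ → ℂ := dslope χ.LFunction (ρ : ℂ) with hF
  have hFdiff : Differentiable ℂ F := by
    have h := (Complex.differentiableOn_dslope
      (Filter.univ_mem : (univ : Set ℂ) ∈ nhds (ρ : ℂ))).2 hLdiff.differentiableOn
    rw [← differentiableOn_univ]
    exact h
  have hfac : ∀ w : ℂ, χ.LFunction w = (w - (ρ : ℂ)) * F w := by
    intro w
    have h := sub_smul_dslope_of_zero hρ0 w
    rw [smul_eq_mul] at h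
    exact h.symm
  -- zero-freeness of `F` on the big ball
  have hF0 : ∀ w ∈ ball c (3 * ε), F w ≠ 0 := by
    intro w hw h0
    by_cases hwρ : w = (ρ : ℂ)
    · rw [hF, hwρ, dslope_same] at h0
      exact hρd h0
    · have hLw : χ.LFunction w = 0 := by rw [hfac w, h0, mul_zero]
      exact hwρ (huniq w hw hLw)
  -- geometry: `d = ‖c − ρ‖ ∈ [ε, 9ε/2]`
  have hcρ : c - (ρ : ℂ) = ((1 + ε - ρ : ℝ) : ℂ) + t * I := by
    rw [hc]; push_cast; ring
  have hd_up : ‖c - (ρ : ℂ)‖ ≤ 9 / 2 * ε := by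
    rw [hcρ]
    calc ‖((1 + ε - ρ : ℝ) : ℂ) + (t : ℂ) * I‖ ≤ ‖((1 + ε - ρ : ℝ) : ℂ)‖ + ‖(t : ℂ) * I‖ :=
          norm_add_le _ _
      _ = |1 + ε - ρ| + |t| := by
          rw [Complex.norm_real, Real.norm_eq_abs, norm_mul, Complex.norm_I, mul_one,
            Complex.norm_real, Real.norm_eq_abs]
      _ ≤ 3 / 2 * ε + 3 * ε := by
          have h1 : 1 + ε - ρ ≤ 3 / 2 * ε := by linarith
          have h2 : 0 ≤ 1 + ε - ρ := by linarith
          rw [abs_of_nonneg h2]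
          linarith [hT]
      _ = 9 / 2 * ε := by ring
  have hd_lo : ε ≤ ‖c - (ρ : ℂ)‖ := by
    have h := abs_re_le_norm (c - (ρ : ℂ))
    have hre : (c - (ρ : ℂ)).re = 1 + ε - ρ := by rw [hcρ]; simp
    rw [hre] at h
    have h2 : ε ≤ 1 + ε - ρ := by linarith
    calc ε ≤ |1 + ε - ρ| := le_trans h2 (le_abs_self _)
      _ ≤ ‖c - (ρ : ℂ)‖ := h
  have hd_pos : 0 < ‖c - (ρ : ℂ)‖ := lt_of_lt_of_le hε0 hd_lo
  -- centre floor: `1/6 ≤ ‖F c‖`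
  have hcre : c.re = 1 + ε := by rw [hc]; simp
  have hLc : ε / (1 + ε) ≤ ‖χ.LFunction c‖ := by
    have h := Literature.NumberTheory.LFunctions.DirichletZFR.norm_LFunction_ge χ
      (s := c) (by rw [hcre]; linarith)
    rw [hcre] at h
    have heq : (1 + ε - 1) / (1 + ε) = ε / (1 + ε) := by ring_nf
    linarith [heq ▸ h]
  have hFc : 1 / 6 ≤ ‖F c‖ := by
    have hfc := hfac c
    have hnorm : ‖χ.LFunction c‖ = ‖c - (ρ : ℂ)‖ * ‖F c‖ := by rw [hfc, norm_mul]
    have hF0c : 0 ≤ ‖F c‖ := norm_nonneg _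
    have h1 : ε / (1 + ε) ≤ 9 / 2 * ε * ‖F c‖ := by
      calc ε / (1 + ε) ≤ ‖c - (ρ : ℂ)‖ * ‖F c‖ := by rw [← hnorm]; exact hLc
        _ ≤ 9 / 2 * ε * ‖F c‖ := mul_le_mul_of_nonneg_right hd_up hF0c
    have h2 : ε * (1 : ℝ) ≤ ε * ((9 / 2) * (1 + ε) * ‖F c‖) := by
      have hε1 : (0 : ℝ) < 1 + ε := by linarith
      rw [div_le_iff₀ hε1] at h1
      nlinarith
    have h3 : (1 : ℝ) ≤ (9 / 2) * (1 + ε) * ‖F c‖ := le_of_mul_le_mul_left (by linarith [h2]) hε0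
    nlinarith [hF0c]
  -- the adaptive sphere radius with margin `ε/20` from `ρ`
  have key : ∀ R₃ : ℝ, 14 / 5 * ε ≤ R₃ → R₃ ≤ 29 / 10 * ε →
      1 / 20 * ε ≤ |R₃ - ‖c - (ρ : ℂ)‖| →
      ‖z - (ρ : ℂ)‖ * (1 / 6 : ℝ) ^ 13 ≤ ‖χ.LFunction z‖ * (20 * B / ε) ^ 12 := by
    intro R₃ hR₃lo hR₃hi hmargin
    have hR₃pos : 0 < R₃ := lt_of_lt_of_le (by positivity) hR₃lo
    have hR₃lt : R₃ < 3 * ε := by linarith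
    -- maximum modulus: `‖F‖ ≤ 20B/ε` on `closedBall c R₃`
    have hFb : ∀ w ∈ closedBall c R₃, ‖F w‖ ≤ 20 * B / ε := by
      intro w hw
      have hcl : closure (ball c R₃) = closedBall c R₃ := closure_ball c hR₃pos.ne'
      refine Complex.norm_le_of_forall_mem_frontier_norm_le (U := ball c R₃)
        isBounded_ball hFdiff.diffContOnCl ?_ (by rw [hcl]; exact hw)
      intro w' hw'
      rw [frontier_ball c hR₃pos.ne'] at hw'
      have hw'c : ‖w' - c‖ = R₃ := by
        have := mem_sphere_iff_norm.mp hw'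
        exact this
      -- distance from the sphere to `ρ`
      have hw'ρ : 1 / 20 * ε ≤ ‖w' - (ρ : ℂ)‖ := by
        have h4 : ‖c - (ρ : ℂ)‖ - R₃ ≤ ‖w' - (ρ : ℂ)‖ := by
          have h3 : ‖c - (ρ : ℂ)‖ ≤ ‖c - w'‖ + ‖w' - (ρ : ℂ)‖ := by
            rw [show c - (ρ : ℂ) = (c - w') + (w' - (ρ : ℂ)) by ring]
            exact norm_add_le _ _
          have hcw : ‖c - w'‖ = R₃ := by rw [norm_sub_rev]; exact hw'c
          linarith
        have h5 : R₃ - ‖c - (ρ : ℂ)‖ ≤ ‖w' - (ρ : ℂ)‖ := by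
          have h6 : ‖w' - c‖ ≤ ‖w' - (ρ : ℂ)‖ + ‖(ρ : ℂ) - c‖ := by
            rw [show w' - c = (w' - (ρ : ℂ)) + ((ρ : ℂ) - c) by ring]
            exact norm_add_le _ _
          rw [hw'c, norm_sub_rev (ρ : ℂ) c] at h6
          linarith
        rcases le_or_gt R₃ ‖c - (ρ : ℂ)‖ with hcs | hcs
        · have heq : |R₃ - ‖c - (ρ : ℂ)‖| = ‖c - (ρ : ℂ)‖ - R₃ := by
            rw [abs_sub_comm]; exact abs_of_nonneg (by linarith)
          rw [heq] at hmargin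
          linarith
        · have heq : |R₃ - ‖c - (ρ : ℂ)‖| = R₃ - ‖c - (ρ : ℂ)‖ :=
            abs_of_nonneg (by linarith)
          rw [heq] at hmargin
          linarith
      have hw'ρne : w' ≠ (ρ : ℂ) := by
        intro h
        rw [h, sub_self, norm_zero] at hw'ρ
        linarith [mul_pos (by norm_num : (0:ℝ) < 1/20) hε0]
      have hw'ball : w' ∈ ball c (3 * ε) := by
        rw [mem_ball, dist_eq_norm]
        rw [hw'c]
        exact hR₃lt
      have hLw' : ‖χ.LFunction w'‖ ≤ B := hB w' hw'ball
      have hnw' : ‖χ.LFunction w'‖ = ‖w' - (ρ : ℂ)‖ * ‖F w'‖ := by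
        rw [hfac w', norm_mul]
      have hw'ρpos : 0 < ‖w' - (ρ : ℂ)‖ :=
        lt_of_lt_of_le (by positivity) hw'ρ
      -- `‖F w'‖ · ‖w'−ρ‖ ≤ B` and `‖w'−ρ‖ ≥ ε/20` give `‖F w'‖ ≤ 20B/ε`
      have hBpos : (0 : ℝ) < B := by linarith
      have h20 : (0 : ℝ) < 20 * B / ε := div_pos (by linarith) hε0
      have hεne : ε ≠ 0 := hε0.ne'
      refine le_of_mul_le_mul_right ?_ hw'ρpos
      calc ‖F w'‖ * ‖w' - (ρ : ℂ)‖ = ‖χ.LFunction w'‖ := by rw [hnw']; ring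
        _ ≤ B := hLw'
        _ = (20 * B / ε) * (1 / 20 * ε) := by field_simp
        _ ≤ (20 * B / ε) * ‖w' - (ρ : ℂ)‖ := by
            exact mul_le_mul_of_nonneg_left hw'ρ h20.le
    -- Borel–Carathéodory floor for `F`
    have hBpos : (0 : ℝ) < B := by linarith
    have hmB' : (1 : ℝ) / 6 < 20 * B / ε := by
      have h8 : (8 : ℝ) ≤ 1 / ε := by
        rw [le_div_iff₀ hε0]; linarith
      have heq : (20 : ℝ) * B / ε = 20 * B * (1 / ε) := by ring
      nlinarith
    have hFd' : DifferentiableOn ℂ F (ball c R₃) := hFdiff.differentiableOn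
    have hF0' : ∀ w ∈ ball c R₃, F w ≠ 0 := fun w hw =>
      hF0 w (ball_subset_ball (by linarith) hw)
    have hB' : ∀ w ∈ ball c R₃, ‖F w‖ ≤ 20 * B / ε := fun w hw =>
      hFb w (ball_subset_closedBall hw)
    have hrR' : 12 / 5 * ε < R₃ := by linarith
    have hk12 : 2 * (12 / 5 * ε) / (R₃ - 12 / 5 * ε) ≤ ((12 : ℕ) : ℝ) := by
      have hpos : 0 < R₃ - 12 / 5 * ε := by linarith
      rw [div_le_iff₀ hpos]
      push_cast
      nlinarith
    have hbc := norm_ge_of_ball_of_le (c := c) (R := R₃)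
      hFd' hF0' (by norm_num : (0 : ℝ) < 1 / 6) hFc hB' hmB'
      (by positivity : (0 : ℝ) ≤ 12 / 5 * ε) hrR' hk12 hz
    -- multiply by `‖z − ρ‖` and refold `L`
    have hzρ0 : 0 ≤ ‖z - (ρ : ℂ)‖ := norm_nonneg _
    have hnz : ‖χ.LFunction z‖ = ‖z - (ρ : ℂ)‖ * ‖F z‖ := by rw [hfac z, norm_mul]
    calc ‖z - (ρ : ℂ)‖ * (1 / 6 : ℝ) ^ 13
        ≤ ‖z - (ρ : ℂ)‖ * (‖F z‖ * (20 * B / ε) ^ 12) := by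
          refine mul_le_mul_of_nonneg_left ?_ hzρ0
          simpa using hbc
      _ = (‖z - (ρ : ℂ)‖ * ‖F z‖) * (20 * B / ε) ^ 12 := by ring
      _ = ‖χ.LFunction z‖ * (20 * B / ε) ^ 12 := by rw [← hnz]
  -- choose the adaptive radius
  rcases le_or_gt (1 / 20 * ε) (|29 / 10 * ε - ‖c - (ρ : ℂ)‖|) with hcase | hcase
  · exact key (29 / 10 * ε) (by linarith) le_rfl hcase
  · have h := abs_lt.mp hcase
    have hd_gt : 57 / 20 * ε < ‖c - (ρ : ℂ)‖ := by linarith [h.2]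
    refine key (14 / 5 * ε) le_rfl (by linarith) ?_
    have hnn : (0 : ℝ) ≤ ‖c - (ρ : ℂ)‖ - 14 / 5 * ε := by linarith
    rw [abs_sub_comm, abs_of_nonneg hnn]
    linarith

end LFunction

end Literature.NumberTheory.LFunctions.Zhang2022.Section8Floor
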